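import Mathlib
import Literature.MathematicalPhysics.QuantumFieldTheory.Balaban1983to89.B5Block118
import Literature.MathematicalPhysics.QuantumFieldTheory.BalabanImbrieJaffe1984to88.BIJ85MomentumSymbols6I
import Literature.MathematicalPhysics.QuantumFieldTheory.BalabanImbrieJaffe1984to88.BIJ85Eq716ConfigLaplacian

/-!
# `BalabanImbrieJaffe1984to88.BIJ85Eq719BlockAverageSymbols` — T. Bałaban, J. Imbrie, A. Jaffe, *Renormalization of the Higgs
model: minimizers, propagators and the stability of mean field theory*, Commun. Math. Phys. **97** (1985) 299–329
[BalabanImbrieJaffe1985]: Sect. 7.1 p. 322 — **(7.1.7)–(7.1.9) FROM CONFIGURATION SPACE on the η-lattice torus**: the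
eigenvalues `v_μ(p) = ∂^{(1)}_μ(p′)/∂_μ(p)` of `V(p) = ∂^{(1)}(p)∂(p)^{−1}` are the symbol of the LINE AVERAGE over the `n = η^{−1}`
fine sites of a unit bond, `u(p) = det V(p) = Π_μ v_μ(p)` is the symbol of the BLOCK AVERAGE over the `n^d` fine sites of a unit
cube, (7.1.7) is the operator factorization `∂^{(1)}_μ = V_μ ∂_μ` (`S_μ^n − 1 = (Σ_{t<n} S_μ^t)(S_μ − 1)`), and (7.1.8): the
unit-lattice difference acting on η-lattice fields has a symbol depending on `p` only through `p′ = p mod 2π` — file 10 of the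
(7.1.2) cluster (`BIJ85Eq715ConfigSymbols`, `BIJ85Eq716ConfigLaplacian`, `BIJ85Eq714FineTorus`)

statement-level skeleton of published theorems with citation tags; proofs where landed; nothing here is a claim about
the Yang–Mills mass gap

PDF held: `paper:balaban1985-cmp97-bij-higgs-minimizers` (journal page = PDF page + 298).  Text read: PDF p. 24 (journal 322).

CITATION HEADER (lean-in-tree rule).  Part of the lit-balaban TYPED SKELETON (HOME `run/shared/lean/pub/lit-balaban/`); WHAT IS
REPRODUCED: displays **(7.1.7)–(7.1.9)** of SKELETON row **C1.Eq7.1.2-7.1.12** (p. 322 [PDF 24], verbatim: *"We require the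
operator V(p) defined by V(p) = ∂^{(1)}(p)∂(p)^{−1}. (7.1.7) Here and below we use the notation p′_i ∈ [−π, π] and p′ = p mod 2π,
(7.1.8) so p′ denotes a unit lattice momentum. The eigenvalues of V(p) are v_μ(p) = ∂^{(1)}_μ(p′)/∂_μ(p). In terms of V(p) we
also define u(p) = det V(p) (7.1.9) … In terms of these functions we can express the averaging operators Q^e_k, etc."*; typed by
r15 as `vSym`, `VMat`, `uSym`, `wrap`), `HOME/lit-balaban-r15/ROWS-C1.md` (owner r15, referee ref-5).  TYPED READING: as in
`BIJ85Eq714FineTorus` — η-torus `Tor (fine n M)` (`Balaban1983to89.B5Prop11Plancherel`), fine dual momenta `p = p′ + l ↔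
B5Block118.pOf n M (k, q)`, `p′ + l = B4Strip.shiftr n k (sOf M q)`; translations `translC a` (`(S_a f)(x,i) = f(x+a,i)`), the
line average `lineAvgC ν = n^{−1} Σ_{t<n} S_{tηe_ν}`, the block average `blockAvgC = n^{−d} Σ_{j∈{0..n−1}^d} S_{ηj}`, the unit-lattice
difference on η-fields `unitDiffC ν = S_{e_ν} − 1` (`e_ν` = n fine steps).  The symbols are [Balaban1984PropagatorsI] (1.31)'s
`v_μ`, `u` in the form `Balaban1983to89.B5Prop11Fiber.vSym/uSym` (value `1` at `∂_μ(p) = 0`); they agree with r15's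
`BIJ85MomentumSymbols71.vSym/uSym` wherever `∂_μ(p′+l) ≠ 0` (seat p10's `BIJ85MomentumSymbols6I.vSym_eq_6I/uSym_eq_6I`) — at the
remaining momenta r15's raw quotient takes the junk value `0/0 = 0` (GAPS G-C1-03) while the averaging symbol is `1`.
WHAT IS KERNEL-CHECKED (zero `sorry`, standard axioms): `translC_mulVec`, `translC_unitVec`, `translC_zero`, `translC_add`,
`translC_tstep_eq_pow`, `isTranslInv_translC`, **`symb_translC`** (`symb S_a q = e^{iq·a}·1`); **`symb_lineAvgC`** (= `v_ν(p′+l)·1`,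
(7.1.7) eigenvalues PROVED as the symbol of the configuration-space line average), `symb_lineAvgC_eq_vSym71`; **`symb_unitDiffC`**
(= `∂^{(1)}_ν(p′)·1 = dOne (sOf M q) ν·1` — (7.1.8): depends on `p′` only), **`unitDiffC_eq_lineAvgC_mul`** ((7.1.7) as the
factorization `∂^{(1)}_ν = (n·lineAvg_ν)(S_ν − 1) = V_ν∂_ν`); **`symb_blockAvgC`** (= `u(p′+l)·1`, (7.1.9) PROVED as the symbol of the
block average), `symb_blockAvgC_eq_uSym71`.  Unit `lit-balaban-p27` (gen 4).
-/

namespace Literature.MathematicalPhysics.QuantumFieldTheory.BalabanImbrieJaffe1984to88.BIJ85Eq719BlockAverageSymbols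

open scoped BigOperators Matrix ComplexConjugate
open Finset Complex
open Literature.MathematicalPhysics.QuantumFieldTheory.Balaban1983to89
open Literature.MathematicalPhysics.QuantumFieldTheory.Balaban1983to89.B5Prop11Plancherel
open Literature.MathematicalPhysics.QuantumFieldTheory.Balaban1983to89.B5Block118
open Literature.MathematicalPhysics.QuantumFieldTheory.BalabanImbrieJaffe1984to88.BIJ85Eq712Plancherel
open Literature.MathematicalPhysics.QuantumFieldTheory.BalabanImbrieJaffe1984to88.BIJ85Eq712SymbolCalculus
open Literature.MathematicalPhysics.QuantumFieldTheory.BalabanImbrieJaffe1984to88.BIJ85Eq715ConfigSymbols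
open Literature.MathematicalPhysics.QuantumFieldTheory.BalabanImbrieJaffe1984to88.BIJ85Eq716ConfigLaplacian
open Literature.MathematicalPhysics.QuantumFieldTheory.BalabanImbrieJaffe1984to88.BIJ85MomentumSymbols71
open Literature.MathematicalPhysics.QuantumFieldTheory.BalabanImbrieJaffe1984to88.BIJ85MomentumSymbols6I

noncomputable section

/-! ## §1 Translations `S_a` on multi-component fields and their symbols `e^{iq·a}` -/

section Transl

variable {d : ℕ} (N : Fin d → ℕ) [hN : ∀ μ, NeZero (N μ)] (m : Type*) [Fintype m] [DecidableEq m]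

/-- The translation `(S_a f)(x, i) = f(x + a, i)` by a lattice vector `a` (the averaging operators of (7.1.10)–(7.1.11) are
normalised sums of these). [cite: BalabanImbrieJaffe1985, (7.1.7) p.322] -/
def translC (a : Tor N) : Matrix (Tor N × m) (Tor N × m) ℂ :=
  Matrix.of fun x y => if y = (x.1 + a, x.2) then 1 else 0

/-- `(S_a f)(x, i) = f(x + a, i)`. [cite: BalabanImbrieJaffe1985, (7.1.7) p.322] -/
theorem translC_mulVec (a : Tor N) (f : Tor N × m → ℂ) (x : Tor N) (i : m) :
    (translC N m a *ᵥ f) (x, i) = f (x + a, i) := by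
  simp only [Matrix.mulVec, dotProduct]
  rw [Finset.sum_eq_single (x + a, i)]
  · simp [translC]
  · intro b _ hb
    simp [translC, hb]
  · exact fun h => absurd (Finset.mem_univ _) h

omit hN [Fintype m] in
/-- `S_{e_ν}` is the unit translation `shiftC ν` of `BIJ85Eq715ConfigSymbols`. [cite: BalabanImbrieJaffe1985, (7.1.7) p.322] -/
theorem translC_unitVec (ν : Fin d) : translC N m (unitVec N ν) = shiftC N m ν := rfl

omit hN [Fintype m] in
/-- `S_0 = 1`. [cite: BalabanImbrieJaffe1985, (7.1.7) p.322] -/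
theorem translC_zero : translC N m 0 = 1 := by
  ext ⟨x, i⟩ ⟨y, j⟩
  simp only [translC, Matrix.of_apply, add_zero, Matrix.one_apply, Prod.mk.injEq]
  by_cases h : x = y
  · subst h
    by_cases hij : i = j
    · subst hij; simp
    · simp [hij, Ne.symm hij]
  · simp [h, Ne.symm h]

/-- `S_{a+b} = S_a S_b`. [cite: BalabanImbrieJaffe1985, (7.1.7) p.322] -/
theorem translC_add (a b : Tor N) : translC N m (a + b) = translC N m a * translC N m b := by
  ext ⟨x, i⟩ ⟨y, j⟩
  rw [Matrix.mul_apply, Finset.sum_eq_single (x + a, i)]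
  · have h1 : translC N m a (x, i) (x + a, i) = 1 := by simp [translC]
    rw [h1, one_mul]
    simp only [translC, Matrix.of_apply, add_assoc]
  · intro z _ hz
    simp only [translC, Matrix.of_apply]
    rw [if_neg hz, zero_mul]
  · exact fun h => absurd (Finset.mem_univ _) h

/-- `S_{te_ν} = S_ν^t` (`tstep ν t = t` fine steps). [cite: BalabanImbrieJaffe1985, (7.1.7) p.322] -/
theorem translC_tstep_eq_pow (ν : Fin d) (t : ℕ) : translC N m (tstep N ν t) = shiftC N m ν ^ t := by
  induction t with
  | zero => rw [tstep_zero, translC_zero, pow_zero]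
  | succ t ih => rw [tstep_succ, translC_add, ih, translC_unitVec, pow_succ]

omit hN [Fintype m] in
/-- `S_a` is translation invariant. [cite: BalabanImbrieJaffe1985, (7.1.7) p.322] -/
theorem isTranslInv_translC (a : Tor N) : IsTranslInv N m (translC N m a) := by
  intro c x y i j
  simp only [translC, Matrix.of_apply, Prod.mk.injEq, add_right_comm x c a, add_left_inj]

omit [Fintype m] in
/-- **`symb S_a q = e^{iq·a}·1`**: translations are the phases of the momentum representation.
[cite: BalabanImbrieJaffe1985, (7.1.7) p.322] -/
theorem symb_translC (a : Tor N) (q : Tor N) : symb N m (translC N m a) q = chi N q a • (1 : Matrix m m ℂ) := by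
  ext i j
  rw [symb_apply, Finset.sum_eq_single (-a)]
  · rw [Matrix.smul_apply, Matrix.one_apply, smul_eq_mul, conj_chi, chi_neg_neg]
    simp only [translC, Matrix.of_apply, Prod.mk.injEq, neg_add_cancel, true_and]
    by_cases h : j = i
    · subst h; simp
    · simp [h, Ne.symm h]
  · intro z _ hz
    rw [translC, Matrix.of_apply, if_neg (fun e => hz (eq_neg_of_add_eq_zero_left ((Prod.mk.inj e).1).symm)), zero_mul]
  · exact fun h => absurd (Finset.mem_univ _) h

end Transl

/-! ## §2 (7.1.7)–(7.1.9) on the η-lattice torus: line and block averages, the unit-lattice difference -/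

section Fine

variable {d : ℕ} (n : ℕ) [NeZero n] (M : Fin d → ℕ) [hM : ∀ μ, NeZero (M μ)] (m : Type*) [Fintype m] [DecidableEq m]

/-- The LINE AVERAGE over the `n = η^{−1}` fine sites of a unit-lattice bond in direction `ν`: `n^{−1} Σ_{t<n} S_{tηe_ν}` (the
one-dimensional factor of the averaging operators, whose symbol is the eigenvalue `v_ν(p)` of (7.1.7)).
[cite: BalabanImbrieJaffe1985, (7.1.7) p.322] -/
def lineAvgC (ν : Fin d) : Matrix (Tor (fine n M) × m) (Tor (fine n M) × m) ℂ :=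
  ((n : ℂ))⁻¹ • ∑ t : Fin n, translC (fine n M) m (tstep (fine n M) ν t)

/-- The BLOCK AVERAGE over the `n^d` fine sites of a unit cube: `n^{−d} Σ_{j ∈ {0,…,n−1}^d} S_{ηj}` (symbol `u(p)` of (7.1.9)).
[cite: BalabanImbrieJaffe1985, (7.1.9) p.322] -/
def blockAvgC : Matrix (Tor (fine n M) × m) (Tor (fine n M) × m) ℂ :=
  ((n : ℂ) ^ d)⁻¹ • ∑ j : Fin d → Fin n, translC (fine n M) m (iota n M j)

/-- The UNIT-LATTICE forward difference acting on η-lattice fields: `∂^{(1)}_ν = S_{e_ν} − 1`, `e_ν` = `n` fine steps (the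
numerator `∂^{(1)}(p′)` of (7.1.7)). [cite: BalabanImbrieJaffe1985, (7.1.7) p.322] -/
def unitDiffC (ν : Fin d) : Matrix (Tor (fine n M) × m) (Tor (fine n M) × m) ℂ :=
  translC (fine n M) m (tstep (fine n M) ν n) - 1

omit [Fintype m] in
/-- **(7.1.7), eigenvalues**: the symbol of the line average at `p = p′ + l` is `v_ν(p)·1`, `v_ν(p) = ∂^{(1)}_ν(p′)/∂_ν(p)`
([Balaban1984PropagatorsI] (1.31)/(1.61), `B5Prop11Fiber.vSym`, value `1` where `∂_ν(p) = 0`).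
[cite: BalabanImbrieJaffe1985, (7.1.7) p.322] -/
theorem symb_lineAvgC (ν : Fin d) (k : Fin d → Fin n) (q : Tor M) :
    symb (fine n M) m (lineAvgC n M m ν) (pOf n M (k, q)) = B5Prop11Fiber.vSym n k (sOf M q) ν • (1 : Matrix m m ℂ) := by
  have hn : (n : ℂ) ≠ 0 := by exact_mod_cast NeZero.ne n
  rw [lineAvgC, ← symbR_eq_symb, symbR_smul, symbR_eq_symb, symb_sum]
  simp_rw [symb_translC, chi_pOf_tstep]
  rw [← Finset.sum_smul, avg_om, smul_smul, inv_mul_cancel_left₀ hn]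

omit [Fintype m] in
/-- … and equals r15's raw quotient `vSym (1/n) (p′+l) ν` of `BIJ85MomentumSymbols71` wherever `∂_ν(p′+l) ≠ 0` (p10's
dictionary; at `∂_ν(p′+l) = 0` the averaging symbol is `1`, the raw quotient `0/0`). [cite: BalabanImbrieJaffe1985, (7.1.7) p.322] -/
theorem symb_lineAvgC_eq_vSym71 (ν : Fin d) (k : Fin d → Fin n) (q : Tor M)
    (hd : dSym (1 / n) (B4Strip.shiftr n k (sOf M q)) ν ≠ 0) :
    symb (fine n M) m (lineAvgC n M m ν) (pOf n M (k, q)) = vSym (1 / n) (B4Strip.shiftr n k (sOf M q)) ν • (1 : Matrix m m ℂ) := by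
  rw [symb_lineAvgC, ← vSym_eq_6I (NeZero.ne n) k (sOf M q) ν hd]

omit [Fintype m] in
/-- **(7.1.8)**: the unit-lattice difference on η-lattice fields has, at `p = p′ + l`, the symbol `∂^{(1)}_ν(p′)·1 =
(e^{ip′_ν} − 1)·1` — it depends on `p` only through *"p′ = p mod 2π, (7.1.8) so p′ denotes a unit lattice momentum"* (r15's `dOne`
at `p′ = sOf M q`). [cite: BalabanImbrieJaffe1985, (7.1.8) p.322] -/
theorem symb_unitDiffC (ν : Fin d) (k : Fin d → Fin n) (q : Tor M) :
    symb (fine n M) m (unitDiffC n M m ν) (pOf n M (k, q)) = dOne (sOf M q) ν • (1 : Matrix m m ℂ) := by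
  rw [unitDiffC, ← symbR_eq_symb, symbR_sub, symbR_one, symbR_eq_symb, symb_translC, chi_pOf_tstep, om_pow, dOne, sub_smul,
    one_smul, mul_comm ((sOf M q ν : ℝ) : ℂ) Complex.I]

/-- **(7.1.7) as an operator identity**: `∂^{(1)}_ν = (n·lineAvg_ν)(S_ν − 1)`, i.e. `S_ν^n − 1 = (Σ_{t<n} S_ν^t)(S_ν − 1)` — with the
lattice factors, `∂^{(1)}_ν = V_ν ∂_ν` for `V_ν = lineAvg_ν`, `∂_ν = η^{−1}(S_ν − 1)`; in symbols `∂^{(1)}_ν(p′) = v_ν(p)∂_ν(p)`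
(`B5Prop11Fiber.d1Sym_eq_vSym_mul`). [cite: BalabanImbrieJaffe1985, (7.1.7) p.322] -/
theorem unitDiffC_eq_lineAvgC_mul (ν : Fin d) :
    unitDiffC n M m ν = ((n : ℂ) • lineAvgC n M m ν) * fdiffC (fine n M) m ν := by
  have hn : (n : ℂ) ≠ 0 := by exact_mod_cast NeZero.ne n
  rw [lineAvgC, smul_smul, mul_inv_cancel₀ hn, one_smul, unitDiffC, fdiffC, translC_tstep_eq_pow]
  simp_rw [translC_tstep_eq_pow]
  rw [Fin.sum_univ_eq_sum_range (fun t => shiftC (fine n M) m ν ^ t) n, geom_sum_mul]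

omit [Fintype m] in
/-- **(7.1.9)**: the symbol of the block average at `p = p′ + l` is `u(p)·1`, `u(p) = det V(p) = Π_μ v_μ(p)`
([Balaban1984PropagatorsI] (1.31), `B5Prop11Fiber.uSym`; the block character sum `B5Block118.sum_chi_iota`).
[cite: BalabanImbrieJaffe1985, (7.1.9) p.322] -/
theorem symb_blockAvgC (k : Fin d → Fin n) (q : Tor M) :
    symb (fine n M) m (blockAvgC n M m) (pOf n M (k, q)) = B5Prop11Fiber.uSym n k (sOf M q) • (1 : Matrix m m ℂ) := by
  have hn : ((n : ℂ) ^ d) ≠ 0 := pow_ne_zero _ (by exact_mod_cast NeZero.ne n)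
  rw [blockAvgC, ← symbR_eq_symb, symbR_smul, symbR_eq_symb, symb_sum]
  simp_rw [symb_translC]
  rw [← Finset.sum_smul, sum_chi_iota, smul_smul, inv_mul_cancel_left₀ hn]

omit [Fintype m] in
/-- … and equals r15's `uSym (1/n) (p′+l)` wherever no `∂_μ(p′+l)` vanishes (p10's dictionary `uSym_eq_6I`).
[cite: BalabanImbrieJaffe1985, (7.1.9) p.322] -/
theorem symb_blockAvgC_eq_uSym71 (k : Fin d → Fin n) (q : Tor M)
    (hd : ∀ μ, dSym (1 / n) (B4Strip.shiftr n k (sOf M q)) μ ≠ 0) :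
    symb (fine n M) m (blockAvgC n M m) (pOf n M (k, q)) = uSym (1 / n) (B4Strip.shiftr n k (sOf M q)) • (1 : Matrix m m ℂ) := by
  rw [symb_blockAvgC, ← uSym_eq_6I (NeZero.ne n) k (sOf M q) hd]

end Fine

end

end Literature.MathematicalPhysics.QuantumFieldTheory.BalabanImbrieJaffe1984to88.BIJ85Eq719BlockAverageSymbols
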